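import Summits.Schanuel.Schanuel.Theorems.ZilberEacDiagonalCriticalExistence
import HarnessLib

/-!
# The critical size with EQUAL fibre polynomials: diagonal-ray solutions (existence)

Zilber's Exponential-Algebraic Closedness, case ladder (host summit Schanuel, cell `pub-schanuel`,
seat 2, gen 13).  THE FAMILY (`e ≥ 1`, `F ∈ ℂ[u]` with coefficients `A₀, …, A_{e-1}`, `A_{e-1} ≠ 0`,
`r₀ ∈ ℝ`, `r₁ = 1/e - r₀`, `c ∈ ℂ`):

  `W = {x₂ = r₀x₀ + r₁x₁ + c,  yⱼ = xⱼ + y₂ F(y₂)} ⊆ ℂ³ × ℂ³`,   `λ(1 + deg F) = (1/e)·e = 1`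

— the critical size with a GENERAL (but equal for `j = 0, 1`) fibre polynomial.  Along the
diagonal rays `x = (2πi e p m + log m)(1,1) + ρ` one has `e^{xⱼ} = m e^{ρⱼ}`,
`y₂ = e^{x₂} = m^{1/e} e^{β}` (`β = c + r·ρ`), so `y₂F(y₂)/m = Σᵢ Aᵢ σ^{e-1-i} e^{(i+1)β}` with the
small parameter `σ = m^{-1/e}`: the rescaled system

  `e^{ρⱼ} = 2πiep + Σᵢ Aᵢ σ^{e-1-i} e^{(i+1)(c + r·ρ)} + ℓ + s ρⱼ`   (`s = 1/m`, `ℓ = log m/m`)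

is ENTIRE in `(σ, s, ℓ; ρ)`, at `σ = s = ℓ = 0` it is the explicitly solvable diagonal limit
`e^{ρ₀} = e^{ρ₁} = P + A_{e-1}e^{e(c + r·ρ)}`, and its Jacobian there has determinant
`E(E - G·e(r₀+r₁)) = E·P ≠ 0`.  **`exists_solutions_criticalEqualFibre`**: for every base solution
there are `ρ(m) → ρ*` with `x(m) = (2πiepm + log m)(1,1) + ρ(m)` solving
`e^{xⱼ} = xⱼ + y₂F(y₂)`, `y₂ = e^{r·x + c}`, for all large `m`.  Density:
`ZilberEacCriticalEqualFibreDensity`.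

HONEST FRAMING: an existence theorem for explicit members of an OPEN cell (`ECCell 3 2`);
NOT Schanuel's conjecture; EAC ⇏ SC.
-/

noncomputable section

open Complex Filter Topology

set_option linter.dupNamespace false

namespace Summit.Schanuel.Schanuel.Theorems

section EqualFibre

/-- The three small parameters `(σ, s, ℓ) = (m^{-1/e}, 1/m, log m/m) → 0`. [folklore] -/
theorem tendsto_rootInv_inv_logDiv (e : ℕ) (he : 1 ≤ e) :
    Tendsto (fun m : ℕ => ((((Real.exp (-(Real.log m / e)) : ℝ)) : ℂ), (((1 / (m : ℝ) : ℝ)) : ℂ),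
      (((Real.log m / (m : ℝ) : ℝ)) : ℂ))) atTop (𝓝 ((0 : ℂ), (0 : ℂ), (0 : ℂ))) := by
  refine Tendsto.prodMk_nhds ?_ tendsto_inv_and_log_div
  have hepos : (0 : ℝ) < e := by exact_mod_cast he
  have h1 : Tendsto (fun m : ℕ => -(Real.log m / e)) atTop atBot := by
    have := (Real.tendsto_log_atTop.comp tendsto_natCast_atTop_atTop).atTop_div_const hepos
    exact tendsto_neg_atTop_atBot.comp this
  have h2 := (continuous_ofReal.tendsto (0 : ℝ)).comp (Real.tendsto_exp_atBot.comp h1)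
  rw [ofReal_zero] at h2
  exact h2

/-- **THEOREM (diagonal-ray solutions at critical size, equal fibre polynomial).**  See the module
docstring: `e ≥ 1`, coefficients `A : ℕ → ℂ`, `p ∈ ℤ ∖ 0`, `P = 2πiep`, and a base pair `ρ*` with
`e^{ρⱼ*} = P + A_{e-1} e^{e(c + r₀ρ₀* + (1/e - r₀)ρ₁*)}` (`j = 0,1`). (new)
[cite: MantovaMasser2023, §1 p.5 (the open case dim π(V) = 2 in ℂ³×ℂˣ³)] -/
theorem exists_solutions_criticalEqualFibre (e : ℕ) (he : 1 ≤ e) (A : ℕ → ℂ) (r₀ : ℝ) (c : ℂ)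
    {p : ℤ} (hp : p ≠ 0) {ρs : ℂ × ℂ}
    (h0 : exp ρs.1 = 2 * Real.pi * I * (e : ℂ) * p +
      A (e - 1) * exp ((e : ℂ) * (c + (r₀ : ℂ) * ρs.1 + ((1 / (e : ℝ) - r₀ : ℝ) : ℂ) * ρs.2)))
    (h1 : exp ρs.2 = 2 * Real.pi * I * (e : ℂ) * p +
      A (e - 1) * exp ((e : ℂ) * (c + (r₀ : ℂ) * ρs.1 + ((1 / (e : ℝ) - r₀ : ℝ) : ℂ) * ρs.2))) :
    ∃ (x : ℕ → Fin 2 → ℂ) (ρ : ℕ → ℂ × ℂ), Tendsto ρ atTop (𝓝 ρs) ∧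
      (∀ m, x m 0 = 2 * Real.pi * I * (e : ℂ) * p * m + Real.log m + (ρ m).1) ∧
      (∀ m, x m 1 = 2 * Real.pi * I * (e : ℂ) * p * m + Real.log m + (ρ m).2) ∧
      (∀ᶠ m in atTop, ∀ j : Fin 2,
        exp (x m j) = x m j + exp (∑ i, ((![r₀, 1 / (e : ℝ) - r₀] : Fin 2 → ℝ) i : ℂ) * x m i + c) *
          ∑ i ∈ Finset.range e, A i *
            (exp (∑ i, ((![r₀, 1 / (e : ℝ) - r₀] : Fin 2 → ℝ) i : ℂ) * x m i + c)) ^ i) := by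
  -- constants
  have he0 : e ≠ 0 := by omega
  have heC : (e : ℂ) ≠ 0 := by exact_mod_cast he0
  have heR : (e : ℝ) ≠ 0 := by exact_mod_cast he0
  set P : ℂ := 2 * Real.pi * I * (e : ℂ) * p with hP
  set r₁ : ℂ := ((1 / (e : ℝ) - r₀ : ℝ) : ℂ) with hr₁
  have hP0 : P ≠ 0 := mul_ne_zero (mul_ne_zero Complex.two_pi_I_ne_zero heC) (by exact_mod_cast hp)
  have hsum : (e : ℂ) * ((r₀ : ℂ) + r₁) = 1 := by
    rw [hr₁]; push_cast; field_simp; ring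
  -- the rescaled system; `β(ρ) = c + r₀ρ₀ + r₁ρ₁`
  set f : (ℂ × ℂ × ℂ) × (ℂ × ℂ) → ℂ × ℂ := fun w =>
    (exp w.2.1 - P - (∑ i ∈ Finset.range e, A i * w.1.1 ^ (e - 1 - i) *
        exp (((i : ℕ) + 1 : ℂ) * (c + (r₀ : ℂ) * w.2.1 + r₁ * w.2.2))) - w.1.2.2 - w.1.2.1 * w.2.1,
      exp w.2.2 - P - (∑ i ∈ Finset.range e, A i * w.1.1 ^ (e - 1 - i) *
        exp (((i : ℕ) + 1 : ℂ) * (c + (r₀ : ℂ) * w.2.1 + r₁ * w.2.2))) - w.1.2.2 - w.1.2.1 * w.2.2)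
    with hf
  have hfC : ContDiff ℂ 1 f := by
    rw [hf]
    fun_prop
  set G : ℂ := A (e - 1) * exp ((e : ℂ) * (c + (r₀ : ℂ) * ρs.1 + r₁ * ρs.2)) with hG
  -- the sum at `σ = 0` collapses to its top term
  have hS0 : ∀ a b : ℂ, (∑ i ∈ Finset.range e, A i * (0 : ℂ) ^ (e - 1 - i) *
      exp (((i : ℕ) + 1 : ℂ) * (c + (r₀ : ℂ) * a + r₁ * b))) =
      A (e - 1) * exp ((e : ℂ) * (c + (r₀ : ℂ) * a + r₁ * b)) := by
    intro a b
    rw [Finset.sum_eq_single (e - 1)]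
    · rw [Nat.sub_self, pow_zero, mul_one]
      congr 2
      push_cast [Nat.cast_sub he]
      ring
    · intro i hi hne
      have hlt : i < e - 1 := lt_of_le_of_ne (Nat.le_sub_one_of_lt (Finset.mem_range.1 hi)) hne
      rw [zero_pow (by omega), mul_zero, zero_mul]
    · intro h; exact absurd (Finset.mem_range.2 (by omega)) h
  have hfq : f (((0 : ℂ), (0 : ℂ), (0 : ℂ)), ρs) = 0 := by
    simp only [hf, Prod.mk_eq_zero, zero_mul, sub_zero, hS0]
    constructor
    · rw [h0, hG]; ring
    · rw [h1, hG]; ring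
  -- the partial derivative and its injectivity
  set L : (ℂ × ℂ) →L[ℂ] (ℂ × ℂ) :=
    ((exp ρs.1 - (e : ℂ) * G * r₀) • ContinuousLinearMap.fst ℂ ℂ ℂ -
        ((e : ℂ) * G * r₁) • ContinuousLinearMap.snd ℂ ℂ ℂ).prod
      (-((e : ℂ) * G * r₀) • ContinuousLinearMap.fst ℂ ℂ ℂ +
        (exp ρs.2 - (e : ℂ) * G * r₁) • ContinuousLinearMap.snd ℂ ℂ ℂ) with hL
  have hLderiv : HasFDerivAt (fun q' : ℂ × ℂ => f (((0 : ℂ), (0 : ℂ), (0 : ℂ)), q')) L ρs := by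
    have eqf : (fun q' : ℂ × ℂ => f (((0 : ℂ), (0 : ℂ), (0 : ℂ)), q')) = fun q' =>
        (exp q'.1 - P - A (e - 1) * exp ((e : ℂ) * (c + (r₀ : ℂ) * q'.1 + r₁ * q'.2)),
          exp q'.2 - P - A (e - 1) * exp ((e : ℂ) * (c + (r₀ : ℂ) * q'.1 + r₁ * q'.2))) := by
      funext q'
      simp only [hf, zero_mul, sub_zero, hS0]
    rw [eqf]
    have ha : HasFDerivAt (fun q' : ℂ × ℂ => q'.1) (ContinuousLinearMap.fst ℂ ℂ ℂ) ρs :=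
      hasFDerivAt_fst
    have hb : HasFDerivAt (fun q' : ℂ × ℂ => q'.2) (ContinuousLinearMap.snd ℂ ℂ ℂ) ρs :=
      hasFDerivAt_snd
    have hlin : HasFDerivAt (fun q' : ℂ × ℂ => (e : ℂ) * (c + (r₀ : ℂ) * q'.1 + r₁ * q'.2))
        ((e : ℂ) • ((r₀ : ℂ) • ContinuousLinearMap.fst ℂ ℂ ℂ + r₁ • ContinuousLinearMap.snd ℂ ℂ ℂ))
        ρs :=
      (((ha.const_mul (r₀ : ℂ)).const_add c).add (hb.const_mul r₁)).const_mul (e : ℂ)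
    have c0 := (ha.cexp.sub_const P).sub (hlin.cexp.const_mul (A (e - 1)))
    have c1 := (hb.cexp.sub_const P).sub (hlin.cexp.const_mul (A (e - 1)))
    refine (c0.prodMk c1).congr_fderiv ?_
    rw [hL, hG]
    ext <;> simp <;> ring
  have hinj : Function.Injective L := by
    refine (injective_iff_map_eq_zero _).2 fun w hw => ?_
    have hw' : (exp ρs.1 - (e : ℂ) * G * r₀) * w.1 - (e : ℂ) * G * r₁ * w.2 = 0 ∧
        -((e : ℂ) * G * r₀) * w.1 + (exp ρs.2 - (e : ℂ) * G * r₁) * w.2 = 0 := by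
      rw [hL] at hw
      simpa [Prod.ext_iff] using hw
    obtain ⟨e0, e1⟩ := hw'
    have hE0 : exp ρs.1 = P + G := by rw [h0, hG]
    have hE1 : exp ρs.2 = P + G := by rw [h1, hG]
    rw [hE0] at e0
    rw [hE1] at e1
    have hPG : P + G ≠ 0 := by rw [← hE0]; exact Complex.exp_ne_zero _
    have hdiff : (P + G) * (w.1 - w.2) = 0 := by linear_combination e0 - e1
    have hw12 : w.1 = w.2 := sub_eq_zero.1 ((mul_eq_zero.1 hdiff).resolve_left hPG)
    have hw1 : P * w.1 = 0 := by
      rw [← hw12] at e0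
      linear_combination e0 + (G * w.1) * hsum
    have hw1' : w.1 = 0 := (mul_eq_zero.1 hw1).resolve_left hP0
    exact Prod.ext hw1' (by rw [← hw12, hw1']; rfl)
  -- the implicit function and the solutions
  obtain ⟨ψ, hψsol, hψlim⟩ := exists_implicit_of_injective_partial hfC hfq hLderiv hinj
  set pr : ℕ → ℂ × ℂ × ℂ := fun m => ((((Real.exp (-(Real.log m / e)) : ℝ)) : ℂ),
    (((1 / (m : ℝ) : ℝ)) : ℂ), (((Real.log m / (m : ℝ) : ℝ)) : ℂ)) with hpr
  have hprt : Tendsto pr atTop (𝓝 ((0 : ℂ), (0 : ℂ), (0 : ℂ))) := tendsto_rootInv_inv_logDiv e he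
  have hρlim : Tendsto (fun m => ψ (pr m)) atTop (𝓝 ρs) := hψlim.comp hprt
  have hsol : ∀ᶠ m in atTop, f (pr m, ψ (pr m)) = 0 := hprt.eventually hψsol
  set x : ℕ → Fin 2 → ℂ := fun m =>
    ![2 * Real.pi * I * (e : ℂ) * p * m + Real.log m + (ψ (pr m)).1,
      2 * Real.pi * I * (e : ℂ) * p * m + Real.log m + (ψ (pr m)).2] with hx
  refine ⟨x, fun m => ψ (pr m), hρlim,
    fun m => by simp only [hx, Matrix.cons_val_zero, hP],
    fun m => by simp only [hx, Matrix.cons_val_one, Matrix.cons_val_zero, hP], ?_⟩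
  filter_upwards [hsol, eventually_ge_atTop 1] with m hm hm1
  have hmpos : (0 : ℝ) < (m : ℝ) := by exact_mod_cast hm1
  have hmC : (m : ℂ) ≠ 0 := by exact_mod_cast (show m ≠ 0 by omega)
  set σ : ℂ := ((Real.exp (-(Real.log m / e)) : ℝ) : ℂ) with hσ
  have hσexp : σ = exp (-(((Real.log m : ℝ) : ℂ) / (e : ℂ))) := by
    rw [hσ, Complex.ofReal_exp]
    congr 1
    push_cast
    ring
  have hexpL : exp ((Real.log m : ℝ) : ℂ) = (m : ℂ) := by
    rw [← Complex.ofReal_exp, Real.exp_log hmpos]; push_cast; rfl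
  have hexpP : exp (2 * Real.pi * I * (e : ℂ) * p * m) = 1 := by
    have := Complex.exp_int_mul_two_pi_mul_I ((e : ℤ) * p * m)
    rw [← this]; congr 1; push_cast; ring
  have hexpP' : exp (2 * Real.pi * I * (p : ℂ) * m) = 1 := by
    have := Complex.exp_int_mul_two_pi_mul_I (p * m)
    rw [← this]; congr 1; push_cast; ring
  have hinv : (m : ℂ) * (1 / (m : ℂ)) = 1 := by field_simp
  have hs : (((1 / (m : ℝ) : ℝ)) : ℂ) = 1 / (m : ℂ) := by push_cast; rfl
  have hl : (((Real.log m / (m : ℝ) : ℝ)) : ℂ) = ((Real.log m : ℝ) : ℂ) * (1 / (m : ℂ)) := by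
    rw [Complex.ofReal_div]; push_cast; ring
  -- `β(m) = c + r₀ρ₀ + r₁ρ₁`, the rescaled sum `S`, and the identities
  set β : ℂ := c + (r₀ : ℂ) * (ψ (pr m)).1 + r₁ * (ψ (pr m)).2 with hβ
  set S : ℂ := ∑ i ∈ Finset.range e, A i * σ ^ (e - 1 - i) * exp (((i : ℕ) + 1 : ℂ) * β) with hS
  have heq : exp (ψ (pr m)).1 = P + S + ((Real.log m : ℝ) : ℂ) * (1 / (m : ℂ)) + 1 / (m : ℂ) * (ψ (pr m)).1 ∧
      exp (ψ (pr m)).2 = P + S + ((Real.log m : ℝ) : ℂ) * (1 / (m : ℂ)) + 1 / (m : ℂ) * (ψ (pr m)).2 := by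
    have hpr1 : (pr m).1 = σ := by simp only [hpr]; rfl
    have hpr2 : (pr m).2.1 = 1 / (m : ℂ) := by simp only [hpr]; exact hs
    have hpr3 : (pr m).2.2 = ((Real.log m : ℝ) : ℂ) * (1 / (m : ℂ)) := by simp only [hpr]; exact hl
    simp only [hf, Prod.mk_eq_zero] at hm
    rw [hpr1, hpr2, hpr3] at hm
    obtain ⟨hm0, hm1'⟩ := hm
    exact ⟨by rw [hS, hβ]; linear_combination hm0, by rw [hS, hβ]; linear_combination hm1'⟩
  obtain ⟨hq0, hq1⟩ := heq
  -- the hyperplane value along the solution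
  have hlin : (∑ i, ((![r₀, 1 / (e : ℝ) - r₀] : Fin 2 → ℝ) i : ℂ) * x m i) + c =
      2 * Real.pi * I * (p : ℂ) * m + ((Real.log m : ℝ) : ℂ) / (e : ℂ) + β := by
    rw [Fin.sum_univ_two]
    simp only [hx, hβ, hr₁, Matrix.cons_val_zero, Matrix.cons_val_one]
    push_cast
    field_simp
    ring
  -- `y₂^{i+1} = m σ^{e-1-i} e^{(i+1)β}`
  have hy : exp (2 * Real.pi * I * (p : ℂ) * m + ((Real.log m : ℝ) : ℂ) / (e : ℂ) + β) = exp (((Real.log m : ℝ) : ℂ) / (e : ℂ)) * exp β := by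
    rw [Complex.exp_add, Complex.exp_add, hexpP', one_mul]
  have hpowi : ∀ i ∈ Finset.range e, (exp (((Real.log m : ℝ) : ℂ) / (e : ℂ)) * exp β) *
      (exp (((Real.log m : ℝ) : ℂ) / (e : ℂ)) * exp β) ^ i =
      (m : ℂ) * (σ ^ (e - 1 - i) * exp (((i : ℕ) + 1 : ℂ) * β)) := by
    intro i hi
    have hie : i < e := Finset.mem_range.1 hi
    have hcast : (((e - 1 - i : ℕ)) : ℂ) = (e : ℂ) - 1 - i := by
      rw [Nat.cast_sub (by omega), Nat.cast_sub he]; push_cast; ring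
    rw [← pow_succ', ← Complex.exp_add, ← Complex.exp_nat_mul, hσexp, ← Complex.exp_nat_mul,
      ← hexpL, ← Complex.exp_add, ← Complex.exp_add]
    congr 1
    rw [hcast]
    push_cast
    field_simp
    ring
  have hSsum : exp (2 * Real.pi * I * (p : ℂ) * m + ((Real.log m : ℝ) : ℂ) / (e : ℂ) + β) *
      ∑ i ∈ Finset.range e, A i * (exp (2 * Real.pi * I * (p : ℂ) * m + ((Real.log m : ℝ) : ℂ) / (e : ℂ) + β)) ^ i =
      (m : ℂ) * S := by
    rw [hy, hS, Finset.mul_sum, Finset.mul_sum]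
    refine Finset.sum_congr rfl fun i hi => ?_
    rw [show exp (((Real.log m : ℝ) : ℂ) / (e : ℂ)) * exp β * (A i * (exp (((Real.log m : ℝ) : ℂ) / (e : ℂ)) * exp β) ^ i) =
      A i * ((exp (((Real.log m : ℝ) : ℂ) / (e : ℂ)) * exp β) * (exp (((Real.log m : ℝ) : ℂ) / (e : ℂ)) * exp β) ^ i) by ring, hpowi i hi]
    ring
  have hx0exp : exp (2 * Real.pi * I * (e : ℂ) * p * m + ((Real.log m : ℝ) : ℂ) + (ψ (pr m)).1) =
      (m : ℂ) * exp (ψ (pr m)).1 := by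
    rw [Complex.exp_add (2 * Real.pi * I * (e : ℂ) * p * m + ((Real.log m : ℝ) : ℂ)),
      Complex.exp_add (2 * Real.pi * I * (e : ℂ) * p * m), hexpP, one_mul, hexpL]
  have hx1exp : exp (2 * Real.pi * I * (e : ℂ) * p * m + ((Real.log m : ℝ) : ℂ) + (ψ (pr m)).2) =
      (m : ℂ) * exp (ψ (pr m)).2 := by
    rw [Complex.exp_add (2 * Real.pi * I * (e : ℂ) * p * m + ((Real.log m : ℝ) : ℂ)),
      Complex.exp_add (2 * Real.pi * I * (e : ℂ) * p * m), hexpP, one_mul, hexpL]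
  intro j
  rw [hlin, hSsum]
  fin_cases j
  · simp only [hx, Fin.zero_eta, Matrix.cons_val_zero]
    rw [hx0exp, hq0, hP]
    push_cast
    linear_combination (Complex.log ((m : ℕ) : ℂ) + (ψ (pr m)).1) * hinv
  · simp only [hx, Fin.mk_one, Matrix.cons_val_one, Matrix.cons_val_zero]
    rw [hx1exp, hq1, hP]
    push_cast
    linear_combination (Complex.log ((m : ℕ) : ℂ) + (ψ (pr m)).2) * hinv

end EqualFibre

end Summit.Schanuel.Schanuel.Theorems

end
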